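import Summits.ABC.IUTFork.Cor312LicenceTripleUnconditional
import Summits.ABC.IUTFork.Conditional.AbcOfSGenuineKLicence
import Summits.ABC.IUTFork.Cor312ThetaSideClosedK
import Summits.ABC.IUTFork.Cor312SettingDHVolWitness
import Summits.ABC.IUTFork.Cor312ProvKIdeles
import HarnessLib

/-!
# Branch C / R-W, reading (U): OUR hull licence S_H holds at EVERY genuine Θ-datum of EVERY abc triple at EVERY prime level
# `l > 4·abc` — the (U) number-level Corollary is COFINITELY TRUE in `l` at every Frey point (abc-iut cell, branch C, row
# «C:COR312U-EVENTUAL»; seat abc-iut-C-cert-2 gen 6)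

Record-only PROOF file (D-0012; 0 definitions, 0 `Prop` facts, nothing re-typed) of the abc-iut cell. TAKES NO SIDE on [IUTchIII]
Cor. 3.12 (S. Mochizuki, *Inter-universal Teichmüller theory III*, Cor. 3.12 p. 173–174; Step (xi-f) p. 184) or on any author; «inhabited
as typed» ≠ «asserted in print». The reading-(U) twin of the «eventually in `l`» theorems of reading (P) (abc-iut-c312-d1
`LDHGenuinePerImageEventual` p498143 / this seat `LDHGenuinePerImageEventually` p497791).

abc-iut-W-row-1's UNCONDITIONAL TRIPLE SOCKET `WRow.licence_triple_unconditional` (p485974) derives abc-iut-c312-1's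
`Thm311ToCor312.Licence` at abc-iut-c312-7's sharp setting of the genuine datum from ONE arithmetic hypothesis `hcell`: per bad prime
`p ≠ 2, l` of `abc`, for every admissible ramification index `e` (`l ∣ e`, `15l ∣ e·v_p`, …), `e` is off the cyclotomic indices and
the floored label cells hold at every label `j ≤ (l−1)/2` for two envelope exponents `A_p, B_p`. The R-W seats discharge `hcell` per triple with
hand-picked exponents and exact thresholds (the numbers of record: `WRow*AllLevels`, `InhUniformBand*`, the REF/INH band files). HERE it is
discharged for EVERY abc triple AT ONCE, crudely, with `A_p = B_p := ⌊v_p(abc)/2⌋`, at every prime `l > 4·abc`: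

* **`WRow.cell_core_of_large`** — the label-cell estimate in `ℤ`: with `e = (2L+1)·K`, `H = K·V`, `V ≤ 2A+1`, `1 ≤ J ≤ L`, `2P ≤ L`,
  `D ≥ e − 1`, `R ≥ 0`: `J²H − J·D − (J+1)·R + (J+1)·(P − A·e) ≤ H` (since `L·V − (2L+1)(1+A) ≤ −(L+1)`, the cell is at most
  `J·(P − L) + P ≤ 0`);
* **`WRow.hcell_triple_of_large`** — `hcell` for every abc triple and every prime `l` with `4·abc < l` (`l > p` puts `e` off the
  cyclotomic indices; `(l−1)/2 ≥ 2·abc ≥ 2·p^{⌊v_p/2⌋}`; the floor only lowers the cell);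
* **`WRow.licence_triple_of_large`** — S_H INHABITED: for every abc triple with `j(a/c) ≠ 1728` (i.e. not `1 + 1 = 2`), every prime
  `l > 4·abc`, every genuine Θ-volume datum `T` of `(a/c, l)` and every pair of realising ideles: `Thm311ToCor312.Licence` at the sharp
  setting — the socket's own conclusion, text VERBATIM;
* **`WRow.cor312Of_triple_of_large`** — hence `T.Cor312Of` (the number-level typed Cor. 3.12 in READING (U)) via abc-iut-C-cert-3's
  `GenuineK.cor312Of_of_licence` and the K-level Θ-side bound, at one-point context data and the chosen realising ideles (the shape of
  `Conditional/AbcOfSCor312OfAllLevels`).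

READING (neutral; numbers, not adjectives): the (U) books' Szpiro-bad number binder (`hNumOffBad`: «¬Licence ⟹ T.Cor312Of») is VACUOUS at
every Frey point `a/c` of every abc triple beyond the level `4·abc`: its antecedent fails there. The threshold is CRUDE BY DESIGN — the R-W
table's exact inhabited thresholds `L_inh(triple)` (rw-num-lead; W-neg-1 / W-num-* / w5-d107 / W-row-* certificates) remain the numbers of record
and are not re-derived here; every tabulated Szpiro-bad `(triple, l)` lies far below `4·abc`. HONEST SCOPE: OUR sharp containers and
Dupuy–Hilado's typed (Ind1)/(Ind2); STRONGER-THAN-PRINT hull reading; non-emptiness of the datum type, admissibility and Szpiro-badness NOT claimed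
(at most finitely many `l` carry genuine data at a point); nothing about the printed GLOBAL inequality; typed ≠ proved; instantiated ≠ endorsed;
no abc claim. [cite: Mochizuki2012, IUTchI Def. 3.1 (b),(c) pp. 61–62, Ex. 3.2 (iv) p. 71; IUTchIII Cor. 3.12 Step (xi-f) p. 184; IUTchIV Prop. 1.2
(i)(ii) p. 10, Prop. 1.4 (ii) p. 13, Cor. 2.2 (ii) proof (P5) p. 46] [cite: DupuyHilado2025, §3.3, §3.4, §4.9, §4.12] [claim: Mochizuki2012,
status: disputed] for every IUT sentence. PROOF-ONLY: no definitions.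
-/

noncomputable section

open Set Function NumberField IsDedekindDomain

namespace Summit.ABC.IUTFork.Conditional

open Thm311 Thm311.Real Cor312 Cor312Vol Cor312Prov Literature.IUT.LogThetaLattice Literature.IUT.LogVolume
  Literature.IUT.HodgeTheaters Literature.IUT.LogVolume.ThetaData Literature.IUT.LogVolume.Cor22
open Literature.NumberTheory.NumberFields Literature.NumberTheory.GaloisRepresentations.Ultrametric
open Literature.NumberTheory.DiophantineGeometry Literature.NumberTheory.DiophantineGeometry.GenEll Summit.ABC.ABC.Theorems

/-! ## §1. The label-cell estimate at large level -/

/-- **The floor-free label cell at a large level, in `ℤ`.** With `e = (2L+1)·K`, `H = K·V`, envelope exponent `A` with `V ≤ 2A+1`,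
`P ≥ 1` (the envelope member `p^A`), `2P ≤ L`, a label `1 ≤ J ≤ L`, `K ≥ 1`, a different term `D ≥ e − 1` and an inner-radius term
`R ≥ 0`: `J²·H − J·D − (J+1)·R + (J+1)·(P − A·e) ≤ H`. Proof: `J²H ≤ J·L·H`, `−J·D ≤ −J·(e−1)`, drop `R`, and
`L·V − (2L+1)·(1+A) ≤ −(L+1)` gives the bound `J·(P − L) + P ≤ −P + P = 0 ≤ H`. [folklore] -/
theorem WRow.cell_core_of_large (J L K V A P D R : ℤ) (hJ1 : 1 ≤ J) (hJL : J ≤ L) (hK : 1 ≤ K) (hV : 0 ≤ V) (hA0 : 0 ≤ A)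
    (hVA : V ≤ 2 * A + 1) (hP1 : 1 ≤ P) (hLP : 2 * P ≤ L) (hD : (2 * L + 1) * K - 1 ≤ D) (hR : 0 ≤ R) :
    J ^ 2 * (K * V) - J * D - (J + 1) * R + (J + 1) * (P - A * ((2 * L + 1) * K)) ≤ K * V := by
  have hJ0 : 0 ≤ J := by linarith
  have hL0 : 0 ≤ L := by linarith
  have hKV : 0 ≤ K * V := mul_nonneg (by linarith) hV
  -- `J²·(KV) ≤ J·L·(KV)`
  have h1 : J ^ 2 * (K * V) ≤ J * L * (K * V) := by
    have := mul_le_mul_of_nonneg_right hJL (mul_nonneg hJ0 hKV)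
    nlinarith
  -- `−J·D ≤ −J·((2L+1)K − 1)`
  have h2 : J * ((2 * L + 1) * K - 1) ≤ J * D := mul_le_mul_of_nonneg_left hD hJ0
  -- `−(J+1)·R ≤ 0`
  have h3 : 0 ≤ (J + 1) * R := mul_nonneg (by linarith) hR
  -- `L·V − (2L+1)(1+A) ≤ −(L+1)`
  have h4 : L * V - (2 * L + 1) * (1 + A) ≤ -(L + 1) := by
    have := mul_le_mul_of_nonneg_left hVA hL0
    nlinarith
  -- `K·(L·V − (2L+1)(1+A)) ≤ −(L+1)` (`K ≥ 1`, the bracket is negative)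
  have h5 : K * (L * V - (2 * L + 1) * (1 + A)) ≤ -(L + 1) := by
    have hneg : L * V - (2 * L + 1) * (1 + A) ≤ 0 := by linarith
    have := mul_le_mul_of_nonpos_right hK hneg
    linarith
  -- `J·(P − L) ≤ P − L ≤ −P`
  have h6 : J * (P - L) ≤ P - L := by
    have hneg : P - L ≤ 0 := by linarith
    have := mul_le_mul_of_nonpos_right hJ1 hneg
    linarith
  -- `−A·(2L+1)·K ≤ 0`
  have h7 : 0 ≤ A * ((2 * L + 1) * K) := mul_nonneg hA0 (mul_nonneg (by linarith) (by linarith))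
  -- assemble: the left side is `≤ J·(K·(LV − (2L+1)(1+A)) + 1 + P) + (P − A(2L+1)K)`
  have h8 : J * (K * (L * V - (2 * L + 1) * (1 + A))) ≤ J * (-(L + 1)) := mul_le_mul_of_nonneg_left h5 hJ0
  nlinarith [h1, h2, h3, h6, h7, h8, hKV]

/-! ## §2. The socket hypothesis `hcell` for every abc triple at every prime `l > 4·abc` -/

/-- **`hcell` of `WRow.licence_triple_unconditional` for EVERY abc triple at EVERY prime `l > 4·abc`, with envelope exponents
`A_p = B_p = ⌊v_p(abc)/2⌋`.** Per bad prime `p ≠ 2, l` and admissible `e` (so `l ∣ e`, `e = l·k`): `e ≠ p^m·(p−1)` because the prime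
`l > p` divides `e`; the `q`-pilot order is `e·v_p/l = k·v_p`; the floored cell is at most the floor-free one (`(x/e)·e ≤ x`), the `min` of
the two (equal) envelope members is the first, the different term is `≥ e − 1` in both branches and the inner-radius term is `≥ 0`; then
`WRow.cell_core_of_large` with `L = (l−1)/2 ≥ 2·abc ≥ 2·p^{⌊v_p/2⌋}`. [cite: Mochizuki2012, IUTchIV Prop. 1.2 (i)(ii) p. 10, Prop. 1.4 (ii)
p. 13] [cite: DupuyHilado2025, §4.9] [claim: Mochizuki2012, status: disputed] -/
theorem WRow.hcell_triple_of_large {a b c l : ℕ} (habc : IsABCTriple a b c) (hl : l.Prime) (hbig : 4 * (a * b * c) < l) :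
    ∀ p : ℕ, p.Prime → p ∣ a * b * c → p ≠ 2 → p ≠ l → ∀ e : ℕ, 0 < e → l ∣ e →
      15 * l ∣ e * (a * b * c).factorization p → (p ∣ 30 → (p - 1) ∣ e) →
      (p ∣ c → Odd ((a * b * c).factorization p) → 30 * l ∣ e * (a * b * c).factorization p) →
      (∀ k : ℕ, (e : ℤ) ≠ (p : ℤ) ^ k * ((p : ℤ) - 1)) ∧
      ∀ i : ℕ, i < (l - 1) / 2 →
        (e : ℤ) * ((((i + 1 : ℕ) : ℤ) ^ 2 * ((e * (2 * (a * b * c).factorization p) / (2 * l) : ℕ) : ℤ) -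
            ((i + 1 : ℕ) : ℤ) * (((if p ∣ 30 ∧ ¬ p ∣ (a * b * c).factorization p then 2 * e - 1 else e - 1 : ℕ) : ℕ) : ℤ) -
            ((i + 2 : ℕ) : ℤ) * (if p ∣ 30 then (((e / (p - 1) : ℕ) : ℤ)) else (1 : ℤ))) / (e : ℤ)) +
          ((i + 2 : ℕ) : ℤ) * min ((p : ℤ) ^ ((fun p => (a * b * c).factorization p / 2) p) -
              (((fun p => (a * b * c).factorization p / 2) p : ℕ) : ℤ) * (e : ℤ))
            ((p : ℤ) ^ ((fun p => (a * b * c).factorization p / 2) p) -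
              (((fun p => (a * b * c).factorization p / 2) p : ℕ) : ℤ) * (e : ℤ)) ≤
        ((e * (2 * (a * b * c).factorization p) / (2 * l) : ℕ) : ℤ) := by
  intro p hp hpabc hp2 hpl e he hle _h15 _h30 _hodd
  simp only []
  have ha : 0 < a := habc.1
  have hb : 0 < b := habc.2.1
  have hc : 0 < c := by have := habc.2.2.1; omega
  have hN : 0 < a * b * c := by positivity
  have hple : p ≤ a * b * c := Nat.le_of_dvd hN hpabc
  have hpltl : p < l := by omega
  -- notation
  set v := (a * b * c).factorization p with hv
  set A := v / 2 with hA
  have hv1 : 1 ≤ v := Nat.Prime.factorization_pos_of_dvd hp hN.ne' hpabc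
  have hpA : p ^ A ≤ a * b * c :=
    le_trans (Nat.pow_le_pow_right hp.pos (Nat.div_le_self v 2)) (by rw [hv]; exact Nat.ordProj_le p hN.ne')
  obtain ⟨k, rfl⟩ := hle
  have hk : 1 ≤ k := by
    rcases Nat.eq_zero_or_pos k with h | h
    · simp [h] at he
    · exact h
  refine ⟨fun m heq => ?_, fun i hi => ?_⟩
  · -- off the cyclotomic indices: `l ∣ p^m (p-1)` is impossible for the prime `l > p`
    have hcast : ((p : ℤ) - 1) = ((p - 1 : ℕ) : ℤ) := by rw [Nat.cast_sub hp.one_le]; simp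
    rw [hcast] at heq
    have heqN : l * k = p ^ m * (p - 1) := by exact_mod_cast heq
    have hdvd : l ∣ p ^ m * (p - 1) := ⟨k, heqN.symm⟩
    rcases (Nat.Prime.prime hl).dvd_or_dvd hdvd with h | h
    · have := (Nat.prime_dvd_prime_iff_eq hl hp).1 (hl.dvd_of_dvd_pow h); omega
    · have := Nat.le_of_dvd (by have := hp.two_le; omega) h; omega
  · -- the label cell
    -- `l = 2L + 1`
    have hl2 : l ≠ 2 := by omega
    have hodd : l % 2 = 1 := Nat.odd_iff.1 (hl.eq_two_or_odd'.resolve_left hl2)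
    set L := (l - 1) / 2 with hL
    have hlL : l = 2 * L + 1 := by omega
    -- the `q`-pilot order `e·2v/(2l) = k·v`
    have hH : l * k * (2 * v) / (2 * l) = k * v := by
      rw [show l * k * (2 * v) = (2 * l) * (k * v) by ring]
      exact Nat.mul_div_cancel_left _ (by omega)
    rw [hH]
    -- the floor and the `min`
    have he0 : ((l * k : ℕ) : ℤ) ≠ 0 := by exact_mod_cast he.ne'
    have hfloor : ∀ x : ℤ, ((l * k : ℕ) : ℤ) * (x / ((l * k : ℕ) : ℤ)) ≤ x := fun x => by
      rw [mul_comm]; exact Int.ediv_mul_le x he0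
    -- the different term and the inner-radius term
    have hD : (2 * (L : ℤ) + 1) * k - 1 ≤
        (((if p ∣ 30 ∧ ¬ p ∣ v then 2 * (l * k) - 1 else l * k - 1 : ℕ) : ℕ) : ℤ) := by
      have hlk1 : 1 ≤ l * k := he
      split_ifs
      · rw [Nat.cast_sub (by omega)]; push_cast; rw [hlL]; push_cast; nlinarith
      · rw [Nat.cast_sub hlk1]; push_cast; rw [hlL]; push_cast; linarith
    have hR : (0 : ℤ) ≤ (if p ∣ 30 then (((l * k / (p - 1) : ℕ) : ℤ)) else (1 : ℤ)) := by
      split_ifs <;> positivity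
    -- the core estimate
    have hJL : ((i + 1 : ℕ) : ℤ) ≤ L := by
      have : i + 1 ≤ L := hi
      exact_mod_cast this
    have hVA : (v : ℤ) ≤ 2 * (A : ℤ) + 1 := by
      have : v ≤ 2 * A + 1 := by omega
      exact_mod_cast this
    have hP1 : (1 : ℤ) ≤ (p : ℤ) ^ A := by exact_mod_cast Nat.one_le_pow A p hp.pos
    have hLP : 2 * (p : ℤ) ^ A ≤ L := by
      have : 2 * p ^ A ≤ L := by omega
      exact_mod_cast this
    have core := WRow.cell_core_of_large ((i + 1 : ℕ) : ℤ) L k v A ((p : ℤ) ^ A) _ _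
      (by exact_mod_cast Nat.succ_pos i) hJL (by exact_mod_cast hk) (by positivity) (by positivity) hVA hP1 hLP hD hR
    -- rewrite `i + 2 = (i+1) + 1` and `e = (2L+1)·k` in the goal, then chain
    have hi2 : ((i + 2 : ℕ) : ℤ) = ((i + 1 : ℕ) : ℤ) + 1 := by push_cast; ring
    have hlZ : (l : ℤ) = 2 * (L : ℤ) + 1 := by rw [hlL]; push_cast; ring
    have hmin := min_le_left ((p : ℤ) ^ A - (A : ℤ) * ((l * k : ℕ) : ℤ)) ((p : ℤ) ^ A - (A : ℤ) * ((l * k : ℕ) : ℤ))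
    have hJ1' : (0 : ℤ) ≤ ((i + 2 : ℕ) : ℤ) := by positivity
    have hmin' := mul_le_mul_of_nonneg_left hmin hJ1'
    have hfl := hfloor ((((i + 1 : ℕ) : ℤ) ^ 2 * ((k * v : ℕ) : ℤ) -
            ((i + 1 : ℕ) : ℤ) * (((if p ∣ 30 ∧ ¬ p ∣ v then 2 * (l * k) - 1 else l * k - 1 : ℕ) : ℕ) : ℤ) -
            ((i + 2 : ℕ) : ℤ) * (if p ∣ 30 then (((l * k / (p - 1) : ℕ) : ℤ)) else (1 : ℤ))))
    rw [hi2] at hfl hmin' ⊢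
    push_cast at core hfl hmin' ⊢
    simp only [hlZ] at core hfl hmin' ⊢
    linarith [core, hfl, hmin']

/-! ## §3. S_H and the (U) number-level Corollary at every genuine datum of every abc triple, `l > 4·abc` -/

/-- **S_H INHABITED at EVERY genuine Θ-datum of EVERY abc triple at EVERY prime `l > 4·abc`** (`j(a/c) ≠ 1728`, i.e. the triple is not
`1 + 1 = 2`): abc-iut-W-row-1's socket `WRow.licence_triple_unconditional` with `hcell := WRow.hcell_triple_of_large` — its conclusion VERBATIM:
for every analytic `logv`, every context datum and EVERY pair of realising Θ- and q-ideles, `Thm311ToCor312.Licence` at the sharp setting.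
[cite: Mochizuki2012, IUTchI Def. 3.1 (b),(c) pp. 61–62; IUTchIII Cor. 3.12 Step (xi-f) p. 184; IUTchIV Prop. 1.2 (i)(ii) p. 10, Prop. 1.4 (ii) p. 13]
[cite: DupuyHilado2025, §3.3, §3.4, §4.9, §4.12] [claim: Mochizuki2012, status: disputed] -/
theorem WRow.licence_triple_of_large {a b c l : ℕ} (habc : IsABCTriple a b c) (hj1728 : Cor22.jInv ((a : ℚ) / c) ≠ 1728)
    (hl : l.Prime) (hbig : 4 * (a * b * c) < l) (T : Cor22.ThetaVolumeDatumAt (ratPoint ((a : ℚ) / c)) l) :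
    letI := T.instFieldF; letI := T.instNumberFieldF; letI := T.instAlgebraF; letI := T.instFieldK
    letI := T.instNumberFieldK; letI := T.instAlgebraK; letI := T.instFieldFbar; letI := T.instAlgebraFbar
    letI := T.instAlgebraKFbar; letI := T.instIsElliptic
    ∀ {logv : PadicLogs T.K} (hlog : LogvAnalytic logv) (M : Type) [Field M] [NumberField M]
      (archPk : ∀ (j : (thetaIndex (pilotDataOfK T.D T.K)).Label) (vQ : (thetaIndex (pilotDataOfK T.D T.K)).VQ),
        Set ((logShellsDH (pilotDataOfK T.D T.K) logv).Packet j vQ))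
      (archSub : ∀ (j : (thetaIndex (pilotDataOfK T.D T.K)).Label) (v : (thetaIndex (pilotDataOfK T.D T.K)).V),
        Set ((logShellsDH (pilotDataOfK T.D T.K) logv).Packet j ((thetaIndex (pilotDataOfK T.D T.K)).over v)))
      (Ψ : ℤ → ∀ v : (thetaIndex (pilotDataOfK T.D T.K)).V, v ∈ (thetaIndex (pilotDataOfK T.D T.K)).Vbad →
        Set ((logShellsDH (pilotDataOfK T.D T.K) logv).StarPacket v))
      (act : ℤ → ∀ v : (thetaIndex (pilotDataOfK T.D T.K)).V, v ∈ (thetaIndex (pilotDataOfK T.D T.K)).Vbad →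
        (logShellsDH (pilotDataOfK T.D T.K) logv).StarPacket v → Module.End ℚ ((logShellsDH (pilotDataOfK T.D T.K) logv).StarPacket v))
      (Mmod : ℤ → ∀ j : (thetaIndex (pilotDataOfK T.D T.K)).LabelStar, Set ((logShellsDH (pilotDataOfK T.D T.K) logv).GlobalPacket j.1))
      (region : ℤ → ∀ j : (thetaIndex (pilotDataOfK T.D T.K)).LabelStar, FinDivisor M → ∀ vQ : (thetaIndex (pilotDataOfK T.D T.K)).VQ,
        Set ((logShellsDH (pilotDataOfK T.D T.K) logv).Packet j.1 vQ))
      (n : ℤ) {HT : Type} {LogLink : HT → HT → Type} {IsFull : ∀ {s t : HT}, LogLink s t → Prop}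
      (lat : LGPGaussianLogThetaLattice LogLink IsFull)
      {Frd : Type} {IsoF : Frd → Frd → Type} {Ob : Frd → Type} {realify : Frd → Frd} {Strip : Type}
      {IsoS : Strip → Strip → Type} {Mv : ∀ v : (thetaIndex (pilotDataOfK T.D T.K)).V, v ∈ (thetaIndex (pilotDataOfK T.D T.K)).Vbad → Type}
      [∀ v h, Monoid (Mv v h)]
      (sig : GlobalLGPFrobenioidSignature (thetaIndex (pilotDataOfK T.D T.K)).lstar (thetaIndex (pilotDataOfK T.D T.K)).V
        (· ∈ (thetaIndex (pilotDataOfK T.D T.K)).Vbad) Frd IsoF Ob realify Strip IsoS Mv)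
      (split : SplittingMonoids Mv) {ObΔ : Type} {N : ∀ v : (thetaIndex (pilotDataOfK T.D T.K)).V, v ∈ (thetaIndex (pilotDataOfK T.D T.K)).Vbad → Type}
      [∀ v h, Monoid (N v h)] (qData : QPilotData ObΔ N)
      (tq : ∀ (pp : Nat.Primes) (x : (thetaIndex (pilotDataOfK T.D T.K)).Fibre (.inr pp)),
        haveI : Fact (pp : ℕ).Prime := ⟨pp.2⟩; kOf (pilotDataOfK T.D T.K) pp.1 x)
      (t : ∀ (pp : Nat.Primes) (_ : Fin (pilotDataOfK T.D T.K).lstar) (x : (thetaIndex (pilotDataOfK T.D T.K)).Fibre (.inr pp)),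
        haveI : Fact (pp : ℕ).Prime := ⟨pp.2⟩; kOf (pilotDataOfK T.D T.K) pp.1 x)
      (htq0 : ∀ pp x, tq pp x ≠ 0)
      (htq1 : ∀ (pp : Nat.Primes) (x : (thetaIndex (pilotDataOfK T.D T.K)).Fibre (.inr pp)),
        haveI : Fact (pp : ℕ).Prime := ⟨pp.2⟩; placeOf (pilotDataOfK T.D T.K) pp.1 x ∉ (pilotDataOfK T.D T.K).S → ‖tq pp x‖ = 1)
      (_ht0 : ∀ pp i x, t pp i x ≠ 0)
      (_ht : ∀ (pp : Nat.Primes) (i : Fin (pilotDataOfK T.D T.K).lstar) (x : (thetaIndex (pilotDataOfK T.D T.K)).Fibre (.inr pp)),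
        haveI : Fact (pp : ℕ).Prime := ⟨pp.2⟩
        Real.log ‖t pp i x‖ = -((pilotDataOfK T.D T.K).thetaPilot i (placeOf (pilotDataOfK T.D T.K) pp.1 x)) *
          logNorm T.K (placeOf (pilotDataOfK T.D T.K) pp.1 x) / localDegree T.K (placeOf (pilotDataOfK T.D T.K) pp.1 x))
      (_htq : ∀ (pp : Nat.Primes) (x : (thetaIndex (pilotDataOfK T.D T.K)).Fibre (.inr pp)),
        haveI : Fact (pp : ℕ).Prime := ⟨pp.2⟩
        Real.log ‖tq pp x‖ = -((pilotDataOfK T.D T.K).qPilot (placeOf (pilotDataOfK T.D T.K) pp.1 x)) *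
          logNorm T.K (placeOf (pilotDataOfK T.D T.K) pp.1 x) / localDegree T.K (placeOf (pilotDataOfK T.D T.K) pp.1 x)),
      Thm311ToCor312.Licence
        (settingPrVolSharp (pilotDataOfK T.D T.K) hlog M archPk archSub Ψ act Mmod region n lat sig split qData tq t htq0 htq1) :=
  WRow.licence_triple_unconditional habc hj1728 T (fun p => (a * b * c).factorization p / 2)
    (fun p => (a * b * c).factorization p / 2) (WRow.hcell_triple_of_large habc hl hbig)

/-- **THE NUMBER-LEVEL TYPED COR. 3.12 IN READING (U) AT EVERY GENUINE DATUM OF EVERY abc TRIPLE, EVERY PRIME `l > 4·abc`** (`j ≠ 1728`):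
`T.Cor312Of`, NO other hypothesis — `WRow.licence_triple_of_large` at one-point context data and the chosen realising ideles of [IUTchI]
Ex. 3.2 (iv), through abc-iut-C-cert-3's `GenuineK.cor312Of_of_licence` and the K-level Θ-side bound (the composition of
`Conditional/AbcOfSCor312OfAllLevels`). READING: the (U) books' binder «¬Licence ⟹ T.Cor312Of» is vacuous there. [cite: Mochizuki2012, IUTchIII
Cor. 3.12 p. 173–174; IUTchIV Cor. 2.2 (ii) proof (P5) p. 46] [claim: Mochizuki2012, status: disputed] -/
theorem WRow.cor312Of_triple_of_large {a b c l : ℕ} (habc : IsABCTriple a b c) (hj1728 : Cor22.jInv ((a : ℚ) / c) ≠ 1728)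
    (hl : l.Prime) (hbig : 4 * (a * b * c) < l) (T : Cor22.ThetaVolumeDatumAt (ratPoint ((a : ℚ) / c)) l) : T.Cor312Of := by
  letI := T.instFieldF; letI := T.instNumberFieldF; letI := T.instAlgebraF; letI := T.instFieldK
  letI := T.instNumberFieldK; letI := T.instAlgebraK; letI := T.instFieldFbar; letI := T.instAlgebraFbar
  letI := T.instAlgebraKFbar; letI := T.instIsElliptic
  obtain ⟨tq, htq0, htq1, htq⟩ := exists_realising_qIdeles_pilotDataOfK T.D
  obtain ⟨t, ht0, ht1, ht⟩ := exists_realising_thetaIdeles_pilotDataOfK T.D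
  exact GenuineK.cor312Of_of_licence T.D T.K ℚ (fun _ _ => ∅) (fun _ _ => ∅) (fun _ _ _ => ∅) (fun _ _ _ => 0) (fun _ _ => ∅)
    (fun _ _ _ _ => ∅) 0 unitLatticeDH (unitSigDH (pilotDataOfK T.D T.K)) (unitSplitDH (pilotDataOfK T.D T.K))
    (unitQDataDH (pilotDataOfK T.D T.K)) t tq T.isVolumeInputOf htq0 htq1 ht0 ht1 htq
    (WRow.licence_triple_of_large habc hj1728 hl hbig T (logvAnalytic_analyticLogv (F := T.K)) ℚ (fun _ _ => ∅) (fun _ _ => ∅)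
      (fun _ _ _ => ∅) (fun _ _ _ => 0) (fun _ _ => ∅) (fun _ _ _ _ => ∅) 0 unitLatticeDH (unitSigDH (pilotDataOfK T.D T.K))
      (unitSplitDH (pilotDataOfK T.D T.K)) (unitQDataDH (pilotDataOfK T.D T.K)) tq t htq0 htq1 ht0 ht htq)
    (negLogTheta_settingPrVolSharp_pilotDataOfK_le_datum T ℚ (fun _ _ => ∅) (fun _ _ => ∅) (fun _ _ _ => ∅) (fun _ _ _ => 0) (fun _ _ => ∅)
      (fun _ _ _ _ => ∅) 0 unitLatticeDH (unitSigDH (pilotDataOfK T.D T.K)) (unitSplitDH (pilotDataOfK T.D T.K)) (unitQDataDH (pilotDataOfK T.D T.K))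
      tq t htq0 htq1 ht0 ht)

/-- **COFINITENESS IN `l` (reading (U))**: for every abc triple with `j(a/c) ≠ 1728` there is an explicit `L` (`= 4·abc + 1`) with `T.Cor312Of` at
every genuine Θ-datum of `(a/c, l)` for every prime `l ≥ L`. [cite: Mochizuki2012, IUTchIII Cor. 3.12 p. 173–174] [claim: Mochizuki2012, status: disputed] -/
theorem WRow.cor312Of_triple_eventually {a b c : ℕ} (habc : IsABCTriple a b c) (hj1728 : Cor22.jInv ((a : ℚ) / c) ≠ 1728) :
    ∃ L : ℕ, ∀ l : ℕ, l.Prime → L ≤ l → ∀ T : Cor22.ThetaVolumeDatumAt (ratPoint ((a : ℚ) / c)) l, T.Cor312Of :=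
  ⟨4 * (a * b * c) + 1, fun _ hl hL T => WRow.cor312Of_triple_of_large habc hj1728 hl hL T⟩

end Summit.ABC.IUTFork.Conditional

end
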